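import Literature.NumberTheory.Rogawski1990.LocalTransferCertificationOffS
import Literature.NumberTheory.Automorphic.OrbitalMeasureSemisimpleRankTwo
import HarnessLib

/-!
# (14.2.1) CERTIFIED off the anisotropic set — the `N = 2` INHABITANT (and admissible orbital-measure supplies at every rank `N ≥ 2`)
(Rogawski (1990), §14.1–14.2 pp. 232–233: «we fix an inner isomorphism `ψ : G′ → G`», «if `v ∉ S`, (14.2.1) is obviously satisfied»; §3.8 p. 30;
§4.9 p. 54; Gelbart (1975), §10 pp. 154–155; Deitmar–Echterhoff (2014), Thm. 1.5.3)

Topic `NumberTheory/Rogawski1990`; namespace `Literature.NumberTheory.Rogawski1990`.  THEOREMS ONLY (no definition, no named fact, no instance,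
no notation).  Sequel of ★ `LocalTransferCertificationOffS` (rank-generic certification of (14.2.1) at the places `v ∉ S` along a family
`ψ : ∀ v, v ∉ S → U(H)(L⁺_v) ≃ₜ* U(H₀)(L⁺_v)`), for the `N = 2` edition of the quasi-split comparison letter of the cell `hodgecm-mathlib` (F0P3a
SPEC-ed1.19c §7 T1g(2,H); P5's engine letters of `Cruxes/HLiu418/Lines/F0_AlbCm`).  In rank `2` the identifications exist only off the finite
anisotropic set `T` of the plane `H` (★ `isEmpty_cmDatum_local_equiv_antidiagTwo_of_not_isIsotropic`; the supply ★
`UnitaryGroup.exists_psiOff_conj_forall_levelMatching_two`), while orbital measures admissible on the regular classes exist at EVERY place on both sides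
(★ `UnitaryGroup.exists_localOrbitalMeasureFamily_regular_two`, ★ `exists_isAdmissibleOn_isRegularElt_antidiagOne`).

* `exists_isAdmissibleOn_isRegularElt_two` — `U(H)(L⁺_v)`, `H ∈ M₂(L)` hermitian non-degenerate: a family admissible on the regular classes (rank-2 twin of ★
  `exists_isAdmissibleOn_isRegularElt_of_three_le`); `exists_isAdmissibleOn_isRegularElt_of_two_le` — the same at every rank `N ≥ 2` by cases.
* `exists_psiOff_measures_isInnerTransferRel_two` — THE `N = 2` INHABITANT: for `H ∈ M₂(L)` hermitian with `det H ≠ 0`, the six conjuncts of ★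
  `exists_psiOff_conj_forall_levelMatching_two` (`S = T`, `S ⊆ S₀`, conjugation, correspondence both ways, level matching off `S₀`) AND THEN total measure
  families `m′_v` on `U(H)(L⁺_v)`, `m_v` on `U(Φ₂)(L⁺_v)` admissible on the regular classes at EVERY `v`, `m_v = (ψ_v)_* m′_v` for `v ∉ S`, with
  (14.2.1) at every `v ∉ S` for every `ψ`-transported pair of pure tensors.  Nothing is said at `v ∈ S` (the local inner-transfer datum at the
  anisotropic places is not this file).

HONEST LABEL: HC_CM is proved only modulo the printed citations until rung 0 closes; this file is unconditional and proves no cell binder.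

## References
* [Rogawski1990] J. Rogawski, Ann. of Math. Stud. 123 (1990), §14.1–14.2 pp. 232–233 ((14.2.1), `ψ`, `S`, `S₀`), §3.8 p. 30, §4.9 p. 54.
* [Gelbart1975] S. Gelbart, *Automorphic forms on adele groups* (1975), §10 pp. 154–155.
* [DeitmarEchterhoff2014] A. Deitmar, S. Echterhoff, *Principles of harmonic analysis*, 2nd ed. (2014), Thm. 1.5.3.
-/

set_option autoImplicit false

noncomputable section

open MeasureTheory NumberField IsDedekindDomain Topology
open scoped Matrix MatrixGroups

namespace Literature.NumberTheory.Rogawski1990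

open Literature.NumberTheory.Automorphic

variable (L : Type) [Field L] [NumberField L] [IsCMField L]

/-! ### Supplies of admissible families at every rank `N ≥ 2` -/

section Supply

variable {N : ℕ}

/-- **`U(H)(L⁺_v)`, `H ∈ M₂(L)` hermitian non-degenerate: an orbital measure family ADMISSIBLE ON THE REGULAR CLASSES exists** (any Borel structures on the
orbit quotients) — the rank-2 twin of ★ `exists_isAdmissibleOn_isRegularElt_of_three_le`, folding ★ `UnitaryGroup.exists_localOrbitalMeasureFamily_regular_two`
(unimodularity of the local unitary plane ★ `modularCharacter_cmDatum_local_two_eq_one`). [cite: Rogawski1990, §4.9 p. 54; §14.2 (14.2.1) p. 232]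
[cite: DeitmarEchterhoff2014, Thm. 1.5.3] -/
theorem exists_isAdmissibleOn_isRegularElt_two (H : Matrix (Fin 2) (Fin 2) L)
    (hH : (H.map (cmConjRingHom L))ᵀ = H) (hdet : H.det ≠ 0) (v : HeightOneSpectrum (𝓞 ↥(maximalRealSubfield L)))
    [MeasurableSpace ((UnitaryGroup.cmDatum L 2 H).Local v)] [BorelSpace ((UnitaryGroup.cmDatum L 2 H).Local v)]
    [∀ γ : (UnitaryGroup.cmDatum L 2 H).Local v,
      MeasurableSpace (((UnitaryGroup.cmDatum L 2 H).Local v) ⧸ Subgroup.centralizer ({γ} : Set ((UnitaryGroup.cmDatum L 2 H).Local v)))]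
    [∀ γ : (UnitaryGroup.cmDatum L 2 H).Local v,
      BorelSpace (((UnitaryGroup.cmDatum L 2 H).Local v) ⧸ Subgroup.centralizer ({γ} : Set ((UnitaryGroup.cmDatum L 2 H).Local v)))] :
    ∃ m : OrbitalMeasureFamily ((UnitaryGroup.cmDatum L 2 H).Local v),
      m.IsAdmissibleOn fun γ => IsRegularElt (γ.val : GL (Fin 2) (UnitaryGroup.LocalRing L v)) := by
  obtain ⟨m, hm⟩ := UnitaryGroup.exists_localOrbitalMeasureFamily_regular_two L H v hH hdet
  exact ⟨m, fun c hc => ⟨(hm c hc).1, (hm c hc).2.1, (hm c hc).2.2.2⟩⟩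

/-- **`U(H)(L⁺_v)`, `H ∈ M_N(L)` hermitian non-degenerate, `N ≥ 2`: an orbital measure family admissible on the regular classes exists** — by cases on
`N = 2` (★ `exists_isAdmissibleOn_isRegularElt_two`) ∕ `N ≥ 3` (★ `exists_isAdmissibleOn_isRegularElt_of_three_le`).
[cite: Rogawski1990, §4.9 p. 54; §14.2 (14.2.1) p. 232] [cite: DeitmarEchterhoff2014, Thm. 1.5.3] -/
theorem exists_isAdmissibleOn_isRegularElt_of_two_le (hN : 2 ≤ N) (H : Matrix (Fin N) (Fin N) L)
    (hH : (H.map (cmConjRingHom L))ᵀ = H) (hdet : H.det ≠ 0) (v : HeightOneSpectrum (𝓞 ↥(maximalRealSubfield L)))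
    [MeasurableSpace ((UnitaryGroup.cmDatum L N H).Local v)] [BorelSpace ((UnitaryGroup.cmDatum L N H).Local v)]
    [∀ γ : (UnitaryGroup.cmDatum L N H).Local v,
      MeasurableSpace (((UnitaryGroup.cmDatum L N H).Local v) ⧸ Subgroup.centralizer ({γ} : Set ((UnitaryGroup.cmDatum L N H).Local v)))]
    [∀ γ : (UnitaryGroup.cmDatum L N H).Local v,
      BorelSpace (((UnitaryGroup.cmDatum L N H).Local v) ⧸ Subgroup.centralizer ({γ} : Set ((UnitaryGroup.cmDatum L N H).Local v)))] :
    ∃ m : OrbitalMeasureFamily ((UnitaryGroup.cmDatum L N H).Local v),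
      m.IsAdmissibleOn fun γ => IsRegularElt (γ.val : GL (Fin N) (UnitaryGroup.LocalRing L v)) := by
  rcases Nat.eq_or_lt_of_le hN with h | h
  · subst h
    exact exists_isAdmissibleOn_isRegularElt_two L H hH hdet v
  · exact exists_isAdmissibleOn_isRegularElt_of_three_le L h H hH hdet v

end Supply

/-! ## §3 The `N = 2` inhabitant: `ψ` off the anisotropic set `T`, measures everywhere, (14.2.1) off `T` -/

section RankTwo

variable (H : Matrix (Fin 2) (Fin 2) L)
  [∀ v : HeightOneSpectrum (𝓞 ↥(maximalRealSubfield L)), MeasurableSpace ((UnitaryGroup.cmDatum L 2 H).Local v)]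
  [∀ v : HeightOneSpectrum (𝓞 ↥(maximalRealSubfield L)), BorelSpace ((UnitaryGroup.cmDatum L 2 H).Local v)]
  [∀ v : HeightOneSpectrum (𝓞 ↥(maximalRealSubfield L)),
    MeasurableSpace ((UnitaryGroup.cmDatum L 2 (Matrix.of fun i j : Fin 2 => if i.val + j.val + 1 = 2 then (1 : L) else 0)).Local v)]
  [∀ v : HeightOneSpectrum (𝓞 ↥(maximalRealSubfield L)),
    BorelSpace ((UnitaryGroup.cmDatum L 2 (Matrix.of fun i j : Fin 2 => if i.val + j.val + 1 = 2 then (1 : L) else 0)).Local v)]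
  [∀ (v : HeightOneSpectrum (𝓞 ↥(maximalRealSubfield L))) (γ : (UnitaryGroup.cmDatum L 2 H).Local v),
    MeasurableSpace ((UnitaryGroup.cmDatum L 2 H).Local v ⧸ Subgroup.centralizer ({γ} : Set ((UnitaryGroup.cmDatum L 2 H).Local v)))]
  [∀ (v : HeightOneSpectrum (𝓞 ↥(maximalRealSubfield L))) (γ : (UnitaryGroup.cmDatum L 2 H).Local v),
    BorelSpace ((UnitaryGroup.cmDatum L 2 H).Local v ⧸ Subgroup.centralizer ({γ} : Set ((UnitaryGroup.cmDatum L 2 H).Local v)))]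
  [∀ (v : HeightOneSpectrum (𝓞 ↥(maximalRealSubfield L)))
    (γ : (UnitaryGroup.cmDatum L 2 (Matrix.of fun i j : Fin 2 => if i.val + j.val + 1 = 2 then (1 : L) else 0)).Local v),
    MeasurableSpace ((UnitaryGroup.cmDatum L 2 (Matrix.of fun i j : Fin 2 => if i.val + j.val + 1 = 2 then (1 : L) else 0)).Local v ⧸
      Subgroup.centralizer ({γ} : Set ((UnitaryGroup.cmDatum L 2 (Matrix.of fun i j : Fin 2 => if i.val + j.val + 1 = 2 then (1 : L) else 0)).Local v)))]
  [∀ (v : HeightOneSpectrum (𝓞 ↥(maximalRealSubfield L)))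
    (γ : (UnitaryGroup.cmDatum L 2 (Matrix.of fun i j : Fin 2 => if i.val + j.val + 1 = 2 then (1 : L) else 0)).Local v),
    BorelSpace ((UnitaryGroup.cmDatum L 2 (Matrix.of fun i j : Fin 2 => if i.val + j.val + 1 = 2 then (1 : L) else 0)).Local v ⧸
      Subgroup.centralizer ({γ} : Set ((UnitaryGroup.cmDatum L 2 (Matrix.of fun i j : Fin 2 => if i.val + j.val + 1 = 2 then (1 : L) else 0)).Local v)))]

/-- **The rank-2 (ix′) inhabitant OFF `T`.**  `H ∈ M₂(L)` hermitian, `det H ≠ 0` (any `δ` with `δ̄ = −δ ≠ 0` to read isotropy through ★ `standingData`):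
there are a `Finset` `S` with `v ∈ S ↔ v ∈ T` (the anisotropic places), ONE family `ψ v hv : U(H)(L⁺_v) ≃ₜ* U(Φ₂)(L⁺_v)` (`v ∉ S`) that is conjugation,
class-preserving both ways and level-matching off a finite `S₀ ⊇ S` (the six conjuncts of ★ `UnitaryGroup.exists_psiOff_conj_forall_levelMatching_two`
VERBATIM), and THEN (`∃ m′ m, …`) TOTAL orbital measure families `m′_v` on `U(H)(L⁺_v)` (★ `exists_isAdmissibleOn_isRegularElt_two`) and `m_v` on `U(Φ₂)(L⁺_v)` (★
`exists_isAdmissibleOn_isRegularElt_antidiagOne` on `S`, transport off `S`), both admissible on the regular classes at EVERY `v`, `m_v = (ψ_v)_* m′_v` for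
`v ∉ S`, such that (14.2.1) holds at every `v ∉ S` for every `ψ`-transported pair of pure tensors — [Rogawski1990, §14.2]: «if `v ∉ S`, (14.2.1) is obviously
satisfied», read in rank `2` where `S ⊇ T` may be non-empty ([§3.8 p. 30]; ★ `isEmpty_cmDatum_local_equiv_antidiagTwo_of_not_isIsotropic`).
[cite: Rogawski1990, §14.2 (14.2.1) pp. 232–233] [cite: Rogawski1990, §3.8 p. 30] [cite: Gelbart1975, §10 pp. 154–155] -/
theorem exists_psiOff_measures_isInnerTransferRel_two (hH : (H.map (cmConjRingHom L))ᵀ = H) (hHd : H.det ≠ 0)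
    {δ : L} (hcδ : IsCMField.complexConj L δ = -δ) (hδ : δ ≠ 0) :
    ∃ (S : Finset (HeightOneSpectrum (𝓞 ↥(maximalRealSubfield L))))
      (ψ : ∀ v : HeightOneSpectrum (𝓞 ↥(maximalRealSubfield L)), v ∉ S → ((UnitaryGroup.cmDatum L 2 H).Local v ≃ₜ*
        (UnitaryGroup.cmDatum L 2 (Matrix.of fun i j : Fin 2 => if i.val + j.val + 1 = 2 then (1 : L) else 0)).Local v))
      (S₀ : Finset (HeightOneSpectrum (𝓞 ↥(maximalRealSubfield L)))),
      (∀ v, v ∈ S ↔ ¬ Liu2021.LemD1.IsIsotropic (Liu2021.LemD1OfPlace.standingData L v (IsCMField.complexConj L) 2 H hcδ hδ le_rfl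
        ((UnitaryGroup.map_cmConjRingHom_eq_map_complexConj L H) ▸ hH) hHd)) ∧
      S ⊆ S₀ ∧
      (∀ v (hv : v ∉ S), ∃ Sv : GL (Fin 2) (UnitaryGroup.LocalRing L v), ∀ g : (UnitaryGroup.cmDatum L 2 H).Local v,
        ((ψ v hv g).val : GL (Fin 2) (UnitaryGroup.LocalRing L v)) = Sv⁻¹ * g.val * Sv) ∧
      (∀ v (hv : v ∉ S) (γ' : (UnitaryGroup.cmDatum L 2 H).Local v),
        Corresponds (UnitaryGroup.conjLocal L (IsCMField.complexConj L) v) ((UnitaryGroup.adelicForm L 2 H).map (UnitaryGroup.adeleToLocal L v))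
          ((UnitaryGroup.adelicForm L 2 (Matrix.of fun i j : Fin 2 => if i.val + j.val + 1 = 2 then (1 : L) else 0)).map
            (UnitaryGroup.adeleToLocal L v)) γ' (ψ v hv γ')) ∧
      (∀ v (hv : v ∉ S) (γ : (UnitaryGroup.cmDatum L 2 (Matrix.of fun i j : Fin 2 => if i.val + j.val + 1 = 2 then (1 : L) else 0)).Local v),
        Corresponds (UnitaryGroup.conjLocal L (IsCMField.complexConj L) v) ((UnitaryGroup.adelicForm L 2 H).map (UnitaryGroup.adeleToLocal L v))
          ((UnitaryGroup.adelicForm L 2 (Matrix.of fun i j : Fin 2 => if i.val + j.val + 1 = 2 then (1 : L) else 0)).map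
            (UnitaryGroup.adeleToLocal L v)) ((ψ v hv).symm γ) γ) ∧
      (∀ v (hv : v ∉ S), v ∉ S₀ → ∀ g,
        ψ v hv g ∈ UnitaryGroup.cmLocalIntegralLevel L 2 (Matrix.of fun i j : Fin 2 => if i.val + j.val + 1 = 2 then (1 : L) else 0) v ↔
          g ∈ UnitaryGroup.cmLocalIntegralLevel L 2 H v) ∧
      ∃ (m' : ∀ v, OrbitalMeasureFamily ((UnitaryGroup.cmDatum L 2 H).Local v))
        (m : ∀ v, OrbitalMeasureFamily
          ((UnitaryGroup.cmDatum L 2 (Matrix.of fun i j : Fin 2 => if i.val + j.val + 1 = 2 then (1 : L) else 0)).Local v)),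
      (∀ v, (m' v).IsAdmissibleOn fun γ => IsRegularElt (γ.val : GL (Fin 2) (UnitaryGroup.LocalRing L v))) ∧
      (∀ v, (m v).IsAdmissibleOn fun γ => IsRegularElt (γ.val : GL (Fin 2) (UnitaryGroup.LocalRing L v))) ∧
      (∀ v (hv : v ∉ S), m v = (m' v).transport (ψ v hv).toMulEquiv (ψ v hv).continuous (ψ v hv).symm.continuous) ∧
      ∀ (T : UnitaryGroup.PureTensor L 2 H)
        (T₀ : UnitaryGroup.PureTensor L 2 (Matrix.of fun i j : Fin 2 => if i.val + j.val + 1 = 2 then (1 : L) else 0)),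
        (∀ v (hv : v ∉ S), T₀.loc v = T.loc v ∘ (ψ v hv).symm) → ∀ v (hv : v ∉ S),
          IsInnerTransferRel
            (A := (UnitaryGroup.cmDatum L 2 (Matrix.of fun i j : Fin 2 => if i.val + j.val + 1 = 2 then (1 : L) else 0)).Local v)
            (B := (UnitaryGroup.cmDatum L 2 H).Local v)
            (Corresponds (UnitaryGroup.conjLocal L (IsCMField.complexConj L) v)
              ((UnitaryGroup.adelicForm L 2 H).map (UnitaryGroup.adeleToLocal L v))
              ((UnitaryGroup.adelicForm L 2 (Matrix.of fun i j : Fin 2 => if i.val + j.val + 1 = 2 then (1 : L) else 0)).map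
                (UnitaryGroup.adeleToLocal L v)))
            (IsStablyConj (UnitaryGroup.conjLocal L (IsCMField.complexConj L) v)
              ((UnitaryGroup.adelicForm L 2 H).map (UnitaryGroup.adeleToLocal L v)))
            (IsStablyConj (UnitaryGroup.conjLocal L (IsCMField.complexConj L) v)
              ((UnitaryGroup.adelicForm L 2 (Matrix.of fun i j : Fin 2 => if i.val + j.val + 1 = 2 then (1 : L) else 0)).map
                (UnitaryGroup.adeleToLocal L v)))
            (fun γ => IsRegularElt (γ.val : GL (Fin 2) (UnitaryGroup.LocalRing L v)))
            (m' v) (m v) (T.loc v) (T₀.loc v) := by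
  obtain ⟨S, ψ, S₀, hS, hSS₀, hconj, hcorr, hcorr', hlev⟩ :=
    UnitaryGroup.exists_psiOff_conj_forall_levelMatching_two L H hH hHd hcδ hδ
  have hsup : ∀ v : HeightOneSpectrum (𝓞 ↥(maximalRealSubfield L)), ∃ m' : OrbitalMeasureFamily ((UnitaryGroup.cmDatum L 2 H).Local v),
      m'.IsAdmissibleOn fun γ => IsRegularElt (γ.val : GL (Fin 2) (UnitaryGroup.LocalRing L v)) :=
    fun v => exists_isAdmissibleOn_isRegularElt_two L H hH hHd v
  have hsup₀ : ∀ v : HeightOneSpectrum (𝓞 ↥(maximalRealSubfield L)), ∃ m₀ : OrbitalMeasureFamily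
      ((UnitaryGroup.cmDatum L 2 (Matrix.of fun i j : Fin 2 => if i.val + j.val + 1 = 2 then (1 : L) else 0)).Local v),
      m₀.IsAdmissibleOn fun γ => IsRegularElt (γ.val : GL (Fin 2) (UnitaryGroup.LocalRing L v)) :=
    fun v => exists_isAdmissibleOn_isRegularElt_antidiagOne L 2 v
  exact ⟨S, ψ, S₀, hS, hSS₀, hconj, hcorr, hcorr', hlev, exists_measures_isInnerTransferRel_offS L H
    (Matrix.of fun i j : Fin 2 => if i.val + j.val + 1 = 2 then (1 : L) else 0) S ψ hcorr hcorr' hsup hsup₀⟩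

end RankTwo

end Literature.NumberTheory.Rogawski1990

end
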